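import Summits.QuantumFields.BalabanUV.Beta.HessKerDressedUnits

/-!
# `BalabanUV.Beta.HessKerDressedUnitsWall` — the wall's ENDs RE-POSED IN ARBITRARY LEG UNITS (`d = 3`): the (CONV-C-Cauchy) data may be supplied
# in ANY unit convention (asymptotic lane asym1, gen 14, v1, part 2 of 2; UNITS-COVARIANT twin of `HessKerDressedCauchy` §3 / `HessKerDressedLimit` §3)

HONEST FRAMING (cell contract, verbatim): «discharging `BetaPertH` makes Bałaban's UV stability UNCONDITIONAL — a real
constructive-QFT result; it is NOT the continuum limit and NOT the Clay problem.»  THIS MODULE applies the tree's ENDs to unit-conjugated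
families (part 1, `HessKerDressedUnits`); it formalises NO statement printed in Bałaban's papers, cites none as a hypothesis, mints no `Prop`
fact, instantiates NO binder of the wall at a value (RULING (R18-3); the colour weights `cE, cVH, cΛ`, the tables `W j`, their localisation
data and the unit sequences `s_f, s_m` stay UNIVERSALLY BOUND; no `UNITS` numeral of `BalabanStepJetsSucc` v1.2 is touched or asserted) and
DISCHARGES NOTHING of it.  NOT summit progress.

ABSOLUTE RULE (cell, verbatim): «No internally-minted statement may enter as a cited fact. Every hypothesis is either
kernel-proved in this package or a verbatim quotation of a PUBLISHED theorem with page reference. The manuscript(s) under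
audit are NOT citable for their own disputed steps — they are the thing under adjudication; programme-internal
(2001/route/tribunal) claims are never citable.»  The data binders below ((CONV-C-Cauchy) in some unit convention) are HYPOTHESIS SHAPES
with free constants, never asserted; nothing here says that Bałaban's objects satisfy them in any units (located, NOT in print: O-asym1-1).

PLACEMENT.  As part 1: cell result under the registered topic `Summits/QuantumFields/BalabanUV/Beta/` (β-lead (R34-2); ≤ 400 lines).

WHY THIS LEAF.  The WALL-LEVEL ENDs of `HessKerDressedCauchy` §3 / `HessKerDressedLimit` §3 ask for `j`-UNIFORM bounds and all-scales
deviations of the RAW typed primitives `KInvStep Lc j`, `(JsBal0Of … j).S`, `W j`; by the UNITS paragraph of `BalabanStepJetsSucc` v1.2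
(PROVISIONAL; motivation only) the typed triple is the `D_j`-conjugate of the one-step-normalised one, `D_j = diag(M⁻¹ ∣ M^{−(d+1)})`, `M = Lc^j`,
so `j`-uniform raw-unit constants are a statement about ONE convention.  Here: for ANY sequences of nonzero leg units `(s_f j, s_m j)` the
wall's member `TbalOf Lc (JsBalOf …) j` IS the dressed Hessian kernel of the RESCALED triple `(D_j K_j D_j, (s_f s_m)⁻¹·D_j⁻¹ S_j D_j⁻¹,
D_j⁻¹ W_j D_j⁻¹)`, `D_j = diag(s_f j ∣ s_m j)` (`TbalOf_JsBalOf_unit`), hence every END holds with its six binders imposed on the rescaled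
triple, SAME explicit constants.  The instance `(s_f j, s_m j) = (Lc^j, Lc^{j(d+1)})` is, by that paragraph's reading, the normalised triple;
NO normalised object is named here — the theorems are exponent-agnostic; the raw-unit ENDs are the instance `s_f = s_m = 1`.

CONTENT (no `def`, no `Prop`; every constant explicit).
* §2 **`TbalOf_JsBalOf_unit`** / `_unit_eq` — the wall's member in any units (an2's `TbalOf_JsBalOf` BY NAME + part 1's `hessKer_dress_unit`).
* §3 THE ENDs IN ANY UNITS (g12 / g13 generic §2 theorems BY NAME at the rescaled families; SAME `κ = c₀ = betaPrime510 4 (lipW …) (R·Lc)`,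
  NO range of `θ` for the all-scales / (PR) forms, `0 ≤ θ < 1` for the equivalences): `allScalesSeq_secondMoment_TbalOf_JsBalOf_unit`;
  LIMIT CURRENCY `geomRate_secondMoment_TbalOf_JsBalOf_lim_unit`, **`d1Drift_JsBalOf_iff_of_lim_unit`**, `d1Drift_JsBalOf_of_lim_eq_unit`;
  CAUCHY CURRENCY `limKernelOf_TbalOf_JsBalOf_apply_unit`, **`d1Drift_JsBalOf_iff_of_cauchy_unit`**, `d1Drift_JsBalOf_of_cauchy_eq_unit`
  (constructed limits `limMKerOf` / `limStOf` / `limTabOf` OF THE RESCALED families, `HessKerDressedLimit` BY NAME).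

UPSHOT FOR THE WALL.  Binder list for road A2 unchanged in CONTENT ({(CONV-C-Cauchy) ; identification}), sharpened in FORM: the six data
binders may be discharged in whichever leg units the supplier's estimates are uniform in, and the identification reads
`secondMoment (hessKer (axDressK Lc K∞) (axVertexOfK K∞ Lc S∞) W∞) μ ν = stepBal N Lc` at the limits of the RESCALED primitives.
WHAT IS NOT HERE (located, NOT in print, NOT claimed): WHICH units make Bałaban's primitives `j`-uniformly bounded and Cauchy (supplier rows
an2 / an4 (R1) / an5 / t4-ne2; Bałaban prints `η`-UNIFORM bounds in running lattice units, not scale-to-scale rates); the identification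
(O-asym1-7); any numeric value of `C, c_•, δ_•, θ, R, s_f, s_m`; `betaPertH_holds`.  NOT continuum, NOT Clay.
-/

open Finset Filter Topology
open scoped BigOperators
open Literature.MathematicalPhysics.QuantumFieldTheory.Balaban1983to89
open Literature.MathematicalPhysics.QuantumFieldTheory.Balaban1983to89.Beta
open B12Sec2to5 (betaPrime510)
open ExpKernelCalculus (MKer Decays BiLoc VertexFamily₂ hessKer Zl)
open LimitRate (limKernelOf)
open HessKerSchur (lipW)
open RemainderConstAllScales (AllScalesSeq allScalesSeq_of_geomRate)
open RateCertificate (GeomRate CauchyRate)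
open OneStepResolventKernel (Fib LocStencil JetData)
open OneStepKernelFamily (KInvStep TbalOf D1Drift)
open AxialDressing (axDressK cAx cN' axVertexOfK)
open BalabanStepJetsSucc (JsBal0Of JsBalOf TbalOf_JsBalOf)
open HessKerDressedCauchy (allScalesSeq_secondMoment_hessKer_dress_of_pointwise d1Drift_iff_lim_eq one_le_Lc)
open HessKerDressedLimit (limMKerOf limStOf limTabOf decays_limMKerOf decays_sub_limMKerOf locStencil_limStOf locStencil_sub_limStOf
  vertexFamily₂_limTabOf vertexFamily₂_sub_limTabOf geomRate_secondMoment_hessKer_dress_of_pointwise_lim limKernelOf_hessKer_dress_apply)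
open Summit.QuantumFields.BalabanUV.Beta.HessKerDressedUnits

namespace Summit.QuantumFields.BalabanUV.Beta.HessKerDressedUnitsWall

/-! ## §2 Dimension four: THE WALL'S FAMILY MEMBER IN ANY UNITS -/

section WallUnits

variable {Lc : ℕ} [NeZero Lc] (hLc : 1 ≤ Lc) (cE cVH cΛ : ℝ)
  (W : ℕ → Fin (3 + 1) → (Fin (3 + 1) → ℤ) → Fin (3 + 1) → (Fin (3 + 1) → ℤ) → MKer (3 + 1) (Fib 3))
  (Cw' δw : ℕ → ℝ) (hδw : ∀ j, 0 < δw j) (hW' : ∀ j, VertexFamily₂ (W j) Lc (Cw' j) (δw j))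
  (sf sm : ℕ → ℝ)

/-- [folklore] **THE WALL'S FAMILY MEMBER IN ANY LEG UNITS**: for an2's literal dressed family and ANY sequences `s_f, s_m : ℕ → ℝ` of
nonzero units, `TbalOf Lc (JsBalOf …) j = hessKer (axDressK Lc (D_j K_j D_j)) (axVertexOfK (D_j K_j D_j) Lc (unitS_j S_j)) (unitW_j W_j)`
with `K_j = KInvStep Lc j`, `S_j = (JsBal0Of … j).S`, `W_j = W j`, `D_j = diag(s_f j ∣ s_m j)` (an2's `TbalOf_JsBalOf` BY NAME + §1). -/
theorem TbalOf_JsBalOf_unit (hsf : ∀ j, sf j ≠ 0) (hsm : ∀ j, sm j ≠ 0) (j : ℕ) :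
    TbalOf Lc (JsBalOf hLc cE cVH cΛ W Cw' δw hδw hW') j =
      hessKer (axDressK Lc (unitK (sf j) (sm j) (KInvStep (d := 3) Lc j)))
        (axVertexOfK (unitK (sf j) (sm j) (KInvStep (d := 3) Lc j)) Lc
          (unitS (sf j) (sm j) (JsBal0Of hLc cE cVH cΛ W Cw' δw hδw hW' j).S))
        (unitW (sf j) (sm j) (W j)) := by
  rw [TbalOf_JsBalOf, hessKer_dress_unit (hsf j) (hsm j)]

/-- [folklore] The family form of `TbalOf_JsBalOf_unit`. -/
theorem TbalOf_JsBalOf_unit_eq (hsf : ∀ j, sf j ≠ 0) (hsm : ∀ j, sm j ≠ 0) :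
    TbalOf Lc (JsBalOf hLc cE cVH cΛ W Cw' δw hδw hW') = fun j =>
      hessKer (axDressK Lc (unitK (sf j) (sm j) (KInvStep (d := 3) Lc j)))
        (axVertexOfK (unitK (sf j) (sm j) (KInvStep (d := 3) Lc j)) Lc
          (unitS (sf j) (sm j) (JsBal0Of hLc cE cVH cΛ W Cw' δw hδw hW' j).S))
        (unitW (sf j) (sm j) (W j)) :=
  funext fun j => TbalOf_JsBalOf_unit hLc cE cVH cΛ W Cw' δw hδw hW' sf sm hsf hsm j

end WallUnits

/-! ## §3 Dimension four: THE ENDs RE-POSED IN ANY UNITS -/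

section EndUnits

variable {Lc : ℕ} [NeZero Lc] (hLc : 1 ≤ Lc) (cE cVH cΛ : ℝ)
  (W : ℕ → Fin (3 + 1) → (Fin (3 + 1) → ℤ) → Fin (3 + 1) → (Fin (3 + 1) → ℤ) → MKer (3 + 1) (Fib 3))
  (Cw' δw : ℕ → ℝ) (hδw : ∀ j, 0 < δw j) (hW' : ∀ j, VertexFamily₂ (W j) Lc (Cw' j) (δw j))
  (sf sm : ℕ → ℝ)
  {Kinf : MKer (3 + 1) (Fib 3)} {Sinf : Fin (3 + 1) → (Fin (3 + 1) → ℤ) → MKer (3 + 1) (Fib 3)}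
  {Winf : Fin (3 + 1) → (Fin (3 + 1) → ℤ) → Fin (3 + 1) → (Fin (3 + 1) → ℤ) → MKer (3 + 1) (Fib 3)}
  {R C cK δK Cs cS δS Cw cW δW θ : ℝ}

/-- [folklore] **THE END INSTANCE OVER `JsBalOf` IN ANY UNITS — SCALAR ALL-SCALES FORM**: `j`-UNIFORM pointwise bounds and ALL-SCALES
deviations with rate `θ` of the RESCALED primitives `D_j K_j D_j`, `unitS_j S_j`, `unitW_j W_j` (any nonzero unit sequences) give
`AllScalesSeq (j ↦ secondMoment (TbalOf Lc (JsBalOf …) j) μ ν) κ θ`, SAME explicit `κ = betaPrime510 4 (lipW …) (R·Lc)` as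
`HessKerDressedCauchy.allScalesSeq_secondMoment_TbalOf_JsBalOf` (its instance `s_f = s_m = 1`).  NO range of `θ`, NO limit object. -/
theorem allScalesSeq_secondMoment_TbalOf_JsBalOf_unit (hsf : ∀ j, sf j ≠ 0) (hsm : ∀ j, sm j ≠ 0)
    (hK : ∀ j, Decays (unitK (sf j) (sm j) (KInvStep (d := 3) Lc j)) C δK)
    (hKall : ∀ k j, Decays (unitK (sf (k + j)) (sm (k + j)) (KInvStep (d := 3) Lc (k + j)) -
      unitK (sf k) (sm k) (KInvStep (d := 3) Lc k)) (cK * θ ^ k) δK)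
    (hS : ∀ j, LocStencil (unitS (sf j) (sm j) (JsBal0Of hLc cE cVH cΛ W Cw' δw hδw hW' j).S) Cs δS)
    (hSall : ∀ k j, LocStencil (unitS (sf (k + j)) (sm (k + j)) (JsBal0Of hLc cE cVH cΛ W Cw' δw hδw hW' (k + j)).S -
      unitS (sf k) (sm k) (JsBal0Of hLc cE cVH cΛ W Cw' δw hδw hW' k).S) (cS * θ ^ k) δS)
    (hW : ∀ j, VertexFamily₂ (unitW (sf j) (sm j) (W j)) Lc Cw δW)
    (hWall : ∀ k j, VertexFamily₂ (unitW (sf (k + j)) (sm (k + j)) (W (k + j)) - unitW (sf k) (sm k) (W k)) Lc (cW * θ ^ k) δW)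
    (hR : 0 < R) (hRK : R < δK) (hRS : R / 2 < δS) (hRW : R < δW) (μ ν : Fin 4) :
    AllScalesSeq (fun j => B12Beta.secondMoment (TbalOf Lc (JsBalOf hLc cE cVH cΛ W Cw' δw hδw hW') j) μ ν)
      (betaPrime510 4
        (lipW ((Fintype.card (Fib 3) : ℝ) * (cAx 3 Lc δK * (cAx 3 Lc δK * C)) * Zl 4 (δK - R))
          ((Fintype.card (Fib 3) : ℝ) * (cAx 3 Lc δK * (cAx 3 Lc δK * C)) * Zl 4 (δK - R))
          ((Fintype.card (Fib 3) : ℝ) * C * Zl 4 (δK - R) * ((Fintype.card (Fib 3) : ℝ) ^ 2 * (cN' 3 Lc δS * Cs) * Zl 4 (δS - R / 2) ^ 2))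
          ((Fintype.card (Fib 3) : ℝ) * C * Zl 4 (δK - R) * ((Fintype.card (Fib 3) : ℝ) ^ 2 * (cN' 3 Lc δS * Cs) * Zl 4 (δS - R / 2) ^ 2))
          ((Fintype.card (Fib 3) : ℝ) ^ 2 * Cw * Zl 4 (δW - R) ^ 2)
          ((Fintype.card (Fib 3) : ℝ) * (cAx 3 Lc δK * (cAx 3 Lc δK * cK)) * Zl 4 (δK - R))
          ((Fintype.card (Fib 3) : ℝ) * cK * Zl 4 (δK - R) * ((Fintype.card (Fib 3) : ℝ) ^ 2 * (cN' 3 Lc δS * Cs) * Zl 4 (δS - R / 2) ^ 2) +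
            (Fintype.card (Fib 3) : ℝ) * C * Zl 4 (δK - R) * ((Fintype.card (Fib 3) : ℝ) ^ 2 * (cN' 3 Lc δS * cS) * Zl 4 (δS - R / 2) ^ 2))
          ((Fintype.card (Fib 3) : ℝ) ^ 2 * cW * Zl 4 (δW - R) ^ 2))
        (R * Lc)) θ :=
  (allScalesSeq_secondMoment_hessKer_dress_of_pointwise (K := fun j => unitK (sf j) (sm j) (KInvStep (d := 3) Lc j))
    (S := fun j => unitS (sf j) (sm j) (JsBal0Of hLc cE cVH cΛ W Cw' δw hδw hW' j).S) (W := fun j => unitW (sf j) (sm j) (W j))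
    one_le_Lc hK hKall hS hSall hW hWall hR hRK hRS hRW μ ν).congr fun j => by
      rw [TbalOf_JsBalOf_unit hLc cE cVH cΛ W Cw' δw hδw hW' sf sm hsf hsm j]

/-- [folklore] **THE END INSTANCE OVER `JsBalOf` IN ANY UNITS — LIMIT CURRENCY**: `j`-uniform bounds on the RESCALED primitives, the same
bounds on ANY named limits `(K∞, S∞, W∞)`, deviations OF THE RESCALED FAMILIES from them with rate `θ` ⟹
`GeomRate (j ↦ secondMoment (TbalOf Lc (JsBalOf …) j) μ ν) (secondMoment (hessKer (axDressK Lc K∞) (axVertexOfK K∞ Lc S∞) W∞) μ ν) c₀ θ`,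
`c₀ = betaPrime510 4 (lipW …) (R·Lc)` EXPLICIT.  NO range of `θ`. -/
theorem geomRate_secondMoment_TbalOf_JsBalOf_lim_unit (hsf : ∀ j, sf j ≠ 0) (hsm : ∀ j, sm j ≠ 0)
    (hK : ∀ j, Decays (unitK (sf j) (sm j) (KInvStep (d := 3) Lc j)) C δK) (hKinf : Decays Kinf C δK)
    (hKrate : ∀ j, Decays (unitK (sf j) (sm j) (KInvStep (d := 3) Lc j) - Kinf) (cK * θ ^ j) δK)
    (hS : ∀ j, LocStencil (unitS (sf j) (sm j) (JsBal0Of hLc cE cVH cΛ W Cw' δw hδw hW' j).S) Cs δS) (hSinf : LocStencil Sinf Cs δS)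
    (hSrate : ∀ j, LocStencil (unitS (sf j) (sm j) (JsBal0Of hLc cE cVH cΛ W Cw' δw hδw hW' j).S - Sinf) (cS * θ ^ j) δS)
    (hW : ∀ j, VertexFamily₂ (unitW (sf j) (sm j) (W j)) Lc Cw δW) (hWinf : VertexFamily₂ Winf Lc Cw δW)
    (hWrate : ∀ j, VertexFamily₂ (unitW (sf j) (sm j) (W j) - Winf) Lc (cW * θ ^ j) δW)
    (hR : 0 < R) (hRK : R < δK) (hRS : R / 2 < δS) (hRW : R < δW) (μ ν : Fin 4) :
    GeomRate (fun j => B12Beta.secondMoment (TbalOf Lc (JsBalOf hLc cE cVH cΛ W Cw' δw hδw hW') j) μ ν)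
      (B12Beta.secondMoment (hessKer (axDressK Lc Kinf) (axVertexOfK Kinf Lc Sinf) Winf) μ ν)
      (betaPrime510 4
        (lipW ((Fintype.card (Fib 3) : ℝ) * (cAx 3 Lc δK * (cAx 3 Lc δK * C)) * Zl 4 (δK - R))
          ((Fintype.card (Fib 3) : ℝ) * (cAx 3 Lc δK * (cAx 3 Lc δK * C)) * Zl 4 (δK - R))
          ((Fintype.card (Fib 3) : ℝ) * C * Zl 4 (δK - R) * ((Fintype.card (Fib 3) : ℝ) ^ 2 * (cN' 3 Lc δS * Cs) * Zl 4 (δS - R / 2) ^ 2))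
          ((Fintype.card (Fib 3) : ℝ) * C * Zl 4 (δK - R) * ((Fintype.card (Fib 3) : ℝ) ^ 2 * (cN' 3 Lc δS * Cs) * Zl 4 (δS - R / 2) ^ 2))
          ((Fintype.card (Fib 3) : ℝ) ^ 2 * Cw * Zl 4 (δW - R) ^ 2)
          ((Fintype.card (Fib 3) : ℝ) * (cAx 3 Lc δK * (cAx 3 Lc δK * cK)) * Zl 4 (δK - R))
          ((Fintype.card (Fib 3) : ℝ) * cK * Zl 4 (δK - R) * ((Fintype.card (Fib 3) : ℝ) ^ 2 * (cN' 3 Lc δS * Cs) * Zl 4 (δS - R / 2) ^ 2) +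
            (Fintype.card (Fib 3) : ℝ) * C * Zl 4 (δK - R) * ((Fintype.card (Fib 3) : ℝ) ^ 2 * (cN' 3 Lc δS * cS) * Zl 4 (δS - R / 2) ^ 2))
          ((Fintype.card (Fib 3) : ℝ) ^ 2 * cW * Zl 4 (δW - R) ^ 2))
        (R * Lc)) θ := by
  rw [TbalOf_JsBalOf_unit_eq hLc cE cVH cΛ W Cw' δw hδw hW' sf sm hsf hsm]
  exact geomRate_secondMoment_hessKer_dress_of_pointwise_lim (K := fun j => unitK (sf j) (sm j) (KInvStep (d := 3) Lc j))
    (S := fun j => unitS (sf j) (sm j) (JsBal0Of hLc cE cVH cΛ W Cw' δw hδw hW' j).S) (W := fun j => unitW (sf j) (sm j) (W j))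
    one_le_Lc hK hKinf hKrate hS hSinf hSrate hW hWinf hWrate hR hRK hRS hRW μ ν

/-- [folklore] **THE WALL ⟺ THE EXPLICIT IDENTIFICATION, LIMIT CURRENCY, ANY UNITS**: under `j`-uniform bounds + rate data of the
RESCALED primitives to ANY named limit primitives `(K∞, S∞, W∞)` and `0 ≤ θ < 1`, THE WALL'S LITERAL TERM
`OneStepKernelFamily.D1Drift Lc (JsBalOf …) N μ ν` holds IFF `secondMoment (hessKer (axDressK Lc K∞) (axVertexOfK K∞ Lc S∞) W∞) μ ν =
B12Normalization.stepBal N Lc` (`HessKerDressedCauchy.d1Drift_iff_lim_eq` + asym2's `allScalesSeq_of_geomRate` + uniqueness of the limit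
value).  Discharges NOTHING. -/
theorem d1Drift_JsBalOf_iff_of_lim_unit (hsf : ∀ j, sf j ≠ 0) (hsm : ∀ j, sm j ≠ 0)
    (hK : ∀ j, Decays (unitK (sf j) (sm j) (KInvStep (d := 3) Lc j)) C δK) (hKinf : Decays Kinf C δK)
    (hKrate : ∀ j, Decays (unitK (sf j) (sm j) (KInvStep (d := 3) Lc j) - Kinf) (cK * θ ^ j) δK)
    (hS : ∀ j, LocStencil (unitS (sf j) (sm j) (JsBal0Of hLc cE cVH cΛ W Cw' δw hδw hW' j).S) Cs δS) (hSinf : LocStencil Sinf Cs δS)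
    (hSrate : ∀ j, LocStencil (unitS (sf j) (sm j) (JsBal0Of hLc cE cVH cΛ W Cw' δw hδw hW' j).S - Sinf) (cS * θ ^ j) δS)
    (hW : ∀ j, VertexFamily₂ (unitW (sf j) (sm j) (W j)) Lc Cw δW) (hWinf : VertexFamily₂ Winf Lc Cw δW)
    (hWrate : ∀ j, VertexFamily₂ (unitW (sf j) (sm j) (W j) - Winf) Lc (cW * θ ^ j) δW)
    (hR : 0 < R) (hRK : R < δK) (hRS : R / 2 < δS) (hRW : R < δW) (hθ0 : 0 ≤ θ) (hθ1 : θ < 1) (μ ν : Fin 4) (N : ℝ) :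
    D1Drift Lc (JsBalOf hLc cE cVH cΛ W Cw' δw hδw hW') N μ ν ↔
      B12Beta.secondMoment (hessKer (axDressK Lc Kinf) (axVertexOfK Kinf Lc Sinf) Winf) μ ν = B12Normalization.stepBal N Lc := by
  have hG := geomRate_secondMoment_TbalOf_JsBalOf_lim_unit hLc cE cVH cΛ W Cw' δw hδw hW' sf sm hsf hsm hK hKinf hKrate hS hSinf hSrate
    hW hWinf hWrate hR hRK hRS hRW μ ν
  have hall := allScalesSeq_of_geomRate hG hθ0 hθ1.le
  have hlim : CauchyRate.lim (fun j => B12Beta.secondMoment (TbalOf Lc (JsBalOf hLc cE cVH cΛ W Cw' δw hδw hW') j) μ ν) =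
      B12Beta.secondMoment (hessKer (axDressK Lc Kinf) (axVertexOfK Kinf Lc Sinf) Winf) μ ν :=
    (hall.cauchyRate.eq_lim hθ1 (hG.tendsto hθ0 hθ1)).symm
  rw [d1Drift_iff_lim_eq (JsBalOf hLc cE cVH cΛ W Cw' δw hδw hW') hall hθ0 hθ1 N, hlim]

/-- [folklore] **THE WALL FROM RATE DATA IN ANY UNITS + THE EXPLICIT IDENTIFICATION** at named limit primitives (the (⇐) direction). -/
theorem d1Drift_JsBalOf_of_lim_eq_unit (hsf : ∀ j, sf j ≠ 0) (hsm : ∀ j, sm j ≠ 0)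
    (hK : ∀ j, Decays (unitK (sf j) (sm j) (KInvStep (d := 3) Lc j)) C δK) (hKinf : Decays Kinf C δK)
    (hKrate : ∀ j, Decays (unitK (sf j) (sm j) (KInvStep (d := 3) Lc j) - Kinf) (cK * θ ^ j) δK)
    (hS : ∀ j, LocStencil (unitS (sf j) (sm j) (JsBal0Of hLc cE cVH cΛ W Cw' δw hδw hW' j).S) Cs δS) (hSinf : LocStencil Sinf Cs δS)
    (hSrate : ∀ j, LocStencil (unitS (sf j) (sm j) (JsBal0Of hLc cE cVH cΛ W Cw' δw hδw hW' j).S - Sinf) (cS * θ ^ j) δS)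
    (hW : ∀ j, VertexFamily₂ (unitW (sf j) (sm j) (W j)) Lc Cw δW) (hWinf : VertexFamily₂ Winf Lc Cw δW)
    (hWrate : ∀ j, VertexFamily₂ (unitW (sf j) (sm j) (W j) - Winf) Lc (cW * θ ^ j) δW)
    (hR : 0 < R) (hRK : R < δK) (hRS : R / 2 < δS) (hRW : R < δW) (hθ0 : 0 ≤ θ) (hθ1 : θ < 1) (μ ν : Fin 4) {N : ℝ}
    (hident : B12Beta.secondMoment (hessKer (axDressK Lc Kinf) (axVertexOfK Kinf Lc Sinf) Winf) μ ν = B12Normalization.stepBal N Lc) :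
    D1Drift Lc (JsBalOf hLc cE cVH cΛ W Cw' δw hδw hW') N μ ν :=
  (d1Drift_JsBalOf_iff_of_lim_unit hLc cE cVH cΛ W Cw' δw hδw hW' sf sm hsf hsm hK hKinf hKrate hS hSinf hSrate hW hWinf hWrate hR hRK
    hRS hRW hθ0 hθ1 μ ν N).2 hident

/-- [folklore] **THE TELESCOPED LIMIT KERNEL OF THE WALL'S FAMILY, EXPLICITLY, FROM DATA IN ANY UNITS**: under the six (CONV-C-Cauchy)
binders ON THE RESCALED primitives and `0 ≤ θ < 1`, entrywise in the `(μ,ν)` component,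
`limKernelOf (TbalOf Lc (JsBalOf …)) μ ν x = hessKer (axDressK Lc K∞) (axVertexOfK K∞ Lc S∞) W∞ μ ν x` at the CONSTRUCTED limits
`K∞ = limMKerOf (j ↦ D_j K_j D_j)`, `S∞ = limStOf (j ↦ unitS_j S_j)`, `W∞ = limTabOf (j ↦ unitW_j W_j)` of the RESCALED families. -/
theorem limKernelOf_TbalOf_JsBalOf_apply_unit (hsf : ∀ j, sf j ≠ 0) (hsm : ∀ j, sm j ≠ 0)
    (hK : ∀ j, Decays (unitK (sf j) (sm j) (KInvStep (d := 3) Lc j)) C δK)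
    (hKall : ∀ k j, Decays (unitK (sf (k + j)) (sm (k + j)) (KInvStep (d := 3) Lc (k + j)) -
      unitK (sf k) (sm k) (KInvStep (d := 3) Lc k)) (cK * θ ^ k) δK)
    (hS : ∀ j, LocStencil (unitS (sf j) (sm j) (JsBal0Of hLc cE cVH cΛ W Cw' δw hδw hW' j).S) Cs δS)
    (hSall : ∀ k j, LocStencil (unitS (sf (k + j)) (sm (k + j)) (JsBal0Of hLc cE cVH cΛ W Cw' δw hδw hW' (k + j)).S -
      unitS (sf k) (sm k) (JsBal0Of hLc cE cVH cΛ W Cw' δw hδw hW' k).S) (cS * θ ^ k) δS)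
    (hW : ∀ j, VertexFamily₂ (unitW (sf j) (sm j) (W j)) Lc Cw δW)
    (hWall : ∀ k j, VertexFamily₂ (unitW (sf (k + j)) (sm (k + j)) (W (k + j)) - unitW (sf k) (sm k) (W k)) Lc (cW * θ ^ k) δW)
    (hR : 0 < R) (hRK : R < δK) (hRS : R / 2 < δS) (hRW : R < δW) (hθ0 : 0 ≤ θ) (hθ1 : θ < 1) (μ ν : Fin 4) (x : Fin 4 → ℤ) :
    limKernelOf (TbalOf Lc (JsBalOf hLc cE cVH cΛ W Cw' δw hδw hW')) μ ν x =
      hessKer (axDressK Lc (limMKerOf fun j => unitK (sf j) (sm j) (KInvStep (d := 3) Lc j)))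
        (axVertexOfK (limMKerOf fun j => unitK (sf j) (sm j) (KInvStep (d := 3) Lc j)) Lc
          (limStOf fun j => unitS (sf j) (sm j) (JsBal0Of hLc cE cVH cΛ W Cw' δw hδw hW' j).S))
        (limTabOf fun j => unitW (sf j) (sm j) (W j)) μ ν x := by
  rw [TbalOf_JsBalOf_unit_eq hLc cE cVH cΛ W Cw' δw hδw hW' sf sm hsf hsm]
  exact limKernelOf_hessKer_dress_apply (K := fun j => unitK (sf j) (sm j) (KInvStep (d := 3) Lc j))
    (S := fun j => unitS (sf j) (sm j) (JsBal0Of hLc cE cVH cΛ W Cw' δw hδw hW' j).S) (W := fun j => unitW (sf j) (sm j) (W j))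
    (Kinf := limMKerOf fun j => unitK (sf j) (sm j) (KInvStep (d := 3) Lc j))
    (Sinf := limStOf fun j => unitS (sf j) (sm j) (JsBal0Of hLc cE cVH cΛ W Cw' δw hδw hW' j).S)
    (Winf := limTabOf fun j => unitW (sf j) (sm j) (W j)) one_le_Lc hK (decays_limMKerOf hK hKall hθ1) (decays_sub_limMKerOf hKall hθ1)
    hS (locStencil_limStOf hS hSall hθ1) (locStencil_sub_limStOf hSall hθ1) hW (vertexFamily₂_limTabOf hW hWall hθ1)
    (vertexFamily₂_sub_limTabOf hWall hθ1) hR hRK hRS hRW hθ0 hθ1 μ ν x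

/-- [folklore] **THE WALL ⟺ THE EXPLICIT IDENTIFICATION AT THE CONSTRUCTED LIMITS, CAUCHY CURRENCY, ANY UNITS** — the six (CONV-C-Cauchy)
binders of `HessKerDressedCauchy.d1Drift_JsBalOf_iff_lim_eq` imposed on the RESCALED primitives (any nonzero unit sequences `s_f, s_m`;
nothing else added) and `0 ≤ θ < 1`:
`D1Drift Lc (JsBalOf …) N μ ν ↔ secondMoment (hessKer (axDressK Lc K∞) (axVertexOfK K∞ Lc S∞) W∞) μ ν = stepBal N Lc` at the constructed
limits of the rescaled families.  The raw-unit statement `HessKerDressedLimit.d1Drift_JsBalOf_iff_of_cauchy` is the instance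
`s_f = s_m = 1`.  Road A2's second half, in explicit unit-covariant form; NOT proved here. -/
theorem d1Drift_JsBalOf_iff_of_cauchy_unit (hsf : ∀ j, sf j ≠ 0) (hsm : ∀ j, sm j ≠ 0)
    (hK : ∀ j, Decays (unitK (sf j) (sm j) (KInvStep (d := 3) Lc j)) C δK)
    (hKall : ∀ k j, Decays (unitK (sf (k + j)) (sm (k + j)) (KInvStep (d := 3) Lc (k + j)) -
      unitK (sf k) (sm k) (KInvStep (d := 3) Lc k)) (cK * θ ^ k) δK)
    (hS : ∀ j, LocStencil (unitS (sf j) (sm j) (JsBal0Of hLc cE cVH cΛ W Cw' δw hδw hW' j).S) Cs δS)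
    (hSall : ∀ k j, LocStencil (unitS (sf (k + j)) (sm (k + j)) (JsBal0Of hLc cE cVH cΛ W Cw' δw hδw hW' (k + j)).S -
      unitS (sf k) (sm k) (JsBal0Of hLc cE cVH cΛ W Cw' δw hδw hW' k).S) (cS * θ ^ k) δS)
    (hW : ∀ j, VertexFamily₂ (unitW (sf j) (sm j) (W j)) Lc Cw δW)
    (hWall : ∀ k j, VertexFamily₂ (unitW (sf (k + j)) (sm (k + j)) (W (k + j)) - unitW (sf k) (sm k) (W k)) Lc (cW * θ ^ k) δW)
    (hR : 0 < R) (hRK : R < δK) (hRS : R / 2 < δS) (hRW : R < δW) (hθ0 : 0 ≤ θ) (hθ1 : θ < 1) (μ ν : Fin 4) (N : ℝ) :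
    D1Drift Lc (JsBalOf hLc cE cVH cΛ W Cw' δw hδw hW') N μ ν ↔
      B12Beta.secondMoment (hessKer (axDressK Lc (limMKerOf fun j => unitK (sf j) (sm j) (KInvStep (d := 3) Lc j)))
        (axVertexOfK (limMKerOf fun j => unitK (sf j) (sm j) (KInvStep (d := 3) Lc j)) Lc
          (limStOf fun j => unitS (sf j) (sm j) (JsBal0Of hLc cE cVH cΛ W Cw' δw hδw hW' j).S))
        (limTabOf fun j => unitW (sf j) (sm j) (W j))) μ ν = B12Normalization.stepBal N Lc :=
  d1Drift_JsBalOf_iff_of_lim_unit hLc cE cVH cΛ W Cw' δw hδw hW' sf sm hsf hsm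
    (Kinf := limMKerOf fun j => unitK (sf j) (sm j) (KInvStep (d := 3) Lc j))
    (Sinf := limStOf fun j => unitS (sf j) (sm j) (JsBal0Of hLc cE cVH cΛ W Cw' δw hδw hW' j).S)
    (Winf := limTabOf fun j => unitW (sf j) (sm j) (W j)) hK (decays_limMKerOf hK hKall hθ1) (decays_sub_limMKerOf hKall hθ1) hS
    (locStencil_limStOf hS hSall hθ1) (locStencil_sub_limStOf hSall hθ1) hW (vertexFamily₂_limTabOf hW hWall hθ1)
    (vertexFamily₂_sub_limTabOf hWall hθ1) hR hRK hRS hRW hθ0 hθ1 μ ν N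

/-- [folklore] **THE WALL FROM (CONV-C-Cauchy) IN ANY UNITS + THE EXPLICIT IDENTIFICATION AT THE CONSTRUCTED LIMITS** (the (⇐) direction). -/
theorem d1Drift_JsBalOf_of_cauchy_eq_unit (hsf : ∀ j, sf j ≠ 0) (hsm : ∀ j, sm j ≠ 0)
    (hK : ∀ j, Decays (unitK (sf j) (sm j) (KInvStep (d := 3) Lc j)) C δK)
    (hKall : ∀ k j, Decays (unitK (sf (k + j)) (sm (k + j)) (KInvStep (d := 3) Lc (k + j)) -
      unitK (sf k) (sm k) (KInvStep (d := 3) Lc k)) (cK * θ ^ k) δK)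
    (hS : ∀ j, LocStencil (unitS (sf j) (sm j) (JsBal0Of hLc cE cVH cΛ W Cw' δw hδw hW' j).S) Cs δS)
    (hSall : ∀ k j, LocStencil (unitS (sf (k + j)) (sm (k + j)) (JsBal0Of hLc cE cVH cΛ W Cw' δw hδw hW' (k + j)).S -
      unitS (sf k) (sm k) (JsBal0Of hLc cE cVH cΛ W Cw' δw hδw hW' k).S) (cS * θ ^ k) δS)
    (hW : ∀ j, VertexFamily₂ (unitW (sf j) (sm j) (W j)) Lc Cw δW)
    (hWall : ∀ k j, VertexFamily₂ (unitW (sf (k + j)) (sm (k + j)) (W (k + j)) - unitW (sf k) (sm k) (W k)) Lc (cW * θ ^ k) δW)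
    (hR : 0 < R) (hRK : R < δK) (hRS : R / 2 < δS) (hRW : R < δW) (hθ0 : 0 ≤ θ) (hθ1 : θ < 1) (μ ν : Fin 4) {N : ℝ}
    (hident : B12Beta.secondMoment (hessKer (axDressK Lc (limMKerOf fun j => unitK (sf j) (sm j) (KInvStep (d := 3) Lc j)))
        (axVertexOfK (limMKerOf fun j => unitK (sf j) (sm j) (KInvStep (d := 3) Lc j)) Lc
          (limStOf fun j => unitS (sf j) (sm j) (JsBal0Of hLc cE cVH cΛ W Cw' δw hδw hW' j).S))
        (limTabOf fun j => unitW (sf j) (sm j) (W j))) μ ν = B12Normalization.stepBal N Lc) :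
    D1Drift Lc (JsBalOf hLc cE cVH cΛ W Cw' δw hδw hW') N μ ν :=
  (d1Drift_JsBalOf_iff_of_cauchy_unit hLc cE cVH cΛ W Cw' δw hδw hW' sf sm hsf hsm hK hKall hS hSall hW hWall hR hRK hRS hRW hθ0 hθ1
    μ ν N).2 hident

end EndUnits

end Summit.QuantumFields.BalabanUV.Beta.HessKerDressedUnitsWall
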